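import Summits.CriticalPhenomena.CardyFormulaZ2.Theorems.CardyAnchoredRigiditySubseqCardyKernelFacts
import Summits.CriticalPhenomena.CardyFormulaZ2.Theorems.CardyAnchoredRigiditySubseqCardyRecurrentSublimit
import Summits.CriticalPhenomena.CardyFormulaZ2.Theorems.CardyAnchoredRigiditySubseqCardyBoxSupermult
import Summits.CriticalPhenomena.CardyFormulaZ2.Theorems.CardyAnchoredRigiditySubseqCardyQuasiadditive
import Summits.CriticalPhenomena.CardyFormulaZ2.Theorems.CardyAnchoredRigiditySubseqCardyExponentSandwich

/-!
# Sequential crossing kernels, IV: the STRIP CROSSING EXPONENT of joint sequential limits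
# (crux `SubseqCardy`, stmt-CriticalPhenomena-5768, line `registered`, lead c6: kernel facts, part IV.3/5/6)

Route `CardyAnchoredRigidity` (decl shared with `CardyLocalRigidity`), sub-problem `CardyFormulaZ2`.
For a JOINT SEQUENTIAL LIMIT (`u → 0⁺`, `g`) of the bond-`ℤ²` crossing probabilities (the object of
S2/S3 and of the cluster set `Λ'`) write `ℓ(w) = g (L_w)` for the box `(0,w) × (0,1)` crossed from its
left to its right side. Parts IV.1/IV.2 (other files of this cycle) give TWO-SIDED quasi-multiplicativity
`½ ℓ(w₁) ℓ(w₂) ≤ ℓ(w₁ + w₂ - 1)`, `ℓ(w₁ + w₂) ≤ ℓ(w₁) ℓ(w₂)` and a real-variable Fekete lemma. Here: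

* `JointLimit.exists_stripExponent` (registered sub-goal `jointLimit_stripExponent`): **every joint
  sequential limit has a STRIP CROSSING EXPONENT** `l = l(g) ≥ log 2` with the sandwich
  `e^{-l w} ≤ ℓ(w) ≤ 2 e^{l (1 - w)}` for EVERY `w > 0` (so `l = lim_{w → ∞} -log ℓ(w) / w`, part IV.4),
  and `l ≤ log 2 - log ℓ(2)`;
* `seqKernel_boundaryQuasiPower`: for a SEQUENTIAL CROSSING KERNEL (`u`, `f`) (HYPSEQ of items 8271 /
  4680 / 8850, of S3 given S2) and the Bollobás–Riordan modulus `η` of the rectangle,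
  `e^{-l w} ≤ f (η w) ≤ 2 e^{l(1-w)}`: every kernel is a quasi-exponential of the aspect ratio at the
  boundary of the modulus range (for Cardy's `F`, `l = π/3`);
* `clusterPt_stripExponent`, `clusterSet_stripExponent_bounds`: on the cluster set `Λ'` of the
  crossing-function path (the phase space of the dilation flow of item 5767 and of line `recurrent`)
  the exponent is a well-defined functional, uniquely pinned by the sandwich, with
  `log 2 ≤ l(g) ≤ M` uniformly (RSW + compactness of `Λ'`); with part IV.4c it is continuous on `Λ'`.

References: B. Bollobás, O. Riordan, *Percolation* (2006), Ch. 3, eq. (2), (3), (12), (13); G. Grimmett,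
*Percolation* (1999), §11.7; J. Cardy, J. Phys. A 25 (1992) L201 (the value `π/3`).
-/

noncomputable section

namespace Summit.CriticalPhenomena.CardyFormulaZ2.Cruxes.SubseqCardy.Birth

open Set Filter Topology
open Literature.Probability.RandomPlanarGeometry
open Literature.Probability.Percolation (bondDomainCrossingProb)
open Summit.CriticalPhenomena.CardyFormulaZ2.Theorems.CardyShadowIsolated.DilationDynamics (clusterSet)

namespace JointLimit

variable {u : ℕ → ℝ} {g : ConformalRectangle → ℝ}

/-- `-log` of a number in `(0,1)` is non-negative. [folklore] -/
theorem neg_log_nonneg_of_mem_Ioo {x : ℝ} (hx : x ∈ Ioo (0:ℝ) 1) : 0 ≤ -Real.log x := by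
  have := Real.log_nonpos hx.1.le hx.2.le
  linarith

/-- **The strip crossing exponent of a joint sequential limit** (registered sub-goal
`jointLimit_stripExponent`). For `u n → 0⁺` and `bondDomainCrossingProb R (u n) → g R` (all `R`) there is
`l ≥ log 2` with `e^{-l w} ≤ g (L_w) ≤ 2 e^{l (1 - w)}` for every box `L_w = (0,w) × (0,1)` crossed
left-to-right and every `w > 0`, and `l ≤ log 2 - log g (L_2)`. Proof: `a(w) = -log g(L_w)` is
non-negative, non-decreasing (`lr_antitone`), superadditive (`lr_submul`) and subadditive up to `log 2`
after a unit shift (`lr_supermul`); the real-variable Fekete lemma `quasiadditive_linear_sandwich` gives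
`l = sup a(w)/w` with `a(w) ≤ l w` and `a(w) ≥ l (w - 1) - log 2`; `a(1) = log 2` by `lrSquare_eq_half`.
[cite: BollobasRiordan2006, Ch. 3, eq. (2), (3) and (12)] -/
theorem exists_stripExponent (hu : Tendsto u atTop (𝓝[>] (0 : ℝ)))
    (hg : ∀ R : ConformalRectangle, Tendsto (fun n => bondDomainCrossingProb R (u n)) atTop (𝓝 (g R))) :
    ∃ l : ℝ, Real.log 2 ≤ l ∧
      (∀ L₂ : ConformalRectangle, L₂.carrier = (Ioo (0:ℝ) 2 ×ℂ Ioo (0:ℝ) 1) →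
        L₂.arc 0 = {z : ℂ | z.re = 0 ∧ z.im ∈ Icc (0:ℝ) 1} →
        L₂.arc 2 = {z : ℂ | z.re = 2 ∧ z.im ∈ Icc (0:ℝ) 1} → l ≤ Real.log 2 - Real.log (g L₂)) ∧
      ∀ w : ℝ, 0 < w → ∀ L : ConformalRectangle, L.carrier = (Ioo (0:ℝ) w ×ℂ Ioo (0:ℝ) 1) →
        L.arc 0 = {z : ℂ | z.re = 0 ∧ z.im ∈ Icc (0:ℝ) 1} →
        L.arc 2 = {z : ℂ | z.re = w ∧ z.im ∈ Icc (0:ℝ) 1} →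
        Real.exp (-(l * w)) ≤ g L ∧ g L ≤ 2 * Real.exp (l * (1 - w)) := by
  classical
  -- one box of each width, and `a(w) = -log g(L_w)`
  let Lb : ℝ → ConformalRectangle := fun w =>
    if h : 0 < w then Classical.choose (exists_lrBox w h) else Classical.choose (exists_lrBox 1 one_pos)
  have hLb : ∀ w : ℝ, 0 < w → (Lb w).carrier = (Ioo (0:ℝ) w ×ℂ Ioo (0:ℝ) 1) ∧
      (Lb w).arc 0 = {z : ℂ | z.re = 0 ∧ z.im ∈ Icc (0:ℝ) 1} ∧
      (Lb w).arc 2 = {z : ℂ | z.re = w ∧ z.im ∈ Icc (0:ℝ) 1} := by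
    intro w hw
    simp only [Lb, dif_pos hw]
    exact Classical.choose_spec (exists_lrBox w hw)
  let a : ℝ → ℝ := fun w => -Real.log (g (Lb w))
  have hIoo : ∀ w : ℝ, g (Lb w) ∈ Ioo (0:ℝ) 1 := fun w => jointLimit_mem_Ioo hu hg _
  -- `a` is non-negative, non-decreasing, superadditive, and subadditive up to `log 2` after a shift
  have hnn : ∀ s : ℝ, 0 < s → 0 ≤ a s := fun s _ => neg_log_nonneg_of_mem_Ioo (hIoo s)
  have hmono : ∀ s t : ℝ, 0 < s → s ≤ t → a s ≤ a t := by
    intro s t hs hst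
    have h := lr_antitone hu hg hs hst (Lb s) (hLb s hs).1 (hLb s hs).2.1 (hLb s hs).2.2
      (Lb t) (hLb t (hs.trans_le hst)).1 (hLb t (hs.trans_le hst)).2.1 (hLb t (hs.trans_le hst)).2.2
    exact neg_le_neg (Real.log_le_log (hIoo t).1 h)
  have hsup : ∀ s t : ℝ, 0 < s → 0 < t → a s + a t ≤ a (s + t) := by
    intro s t hs ht
    have hst : 0 < s + t := add_pos hs ht
    have h := lr_submul hu hg hs ht rfl (Lb s) (hLb s hs).1 (hLb s hs).2.1 (hLb s hs).2.2
      (Lb t) (hLb t ht).1 (hLb t ht).2.1 (hLb t ht).2.2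
      (Lb (s + t)) (hLb _ hst).1 (hLb _ hst).2.1 (hLb _ hst).2.2
    have hlog := Real.log_le_log (hIoo (s + t)).1 h
    rw [Real.log_mul (hIoo s).1.ne' (hIoo t).1.ne'] at hlog
    show -Real.log (g (Lb s)) + -Real.log (g (Lb t)) ≤ -Real.log (g (Lb (s + t)))
    linarith
  have hsub : ∀ s t : ℝ, 1 ≤ s → 1 ≤ t → a (s + t - 1) ≤ a s + a t + Real.log 2 := by
    intro s t hs ht
    have hs0 : 0 < s := by linarith
    have ht0 : 0 < t := by linarith
    have hst : 0 < s + t - 1 := by linarith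
    have h := jointLimit_lr_supermul u hu g hg s t hs ht (Lb s) (hLb s hs0).1 (hLb s hs0).2.1
      (hLb s hs0).2.2 (Lb t) (hLb t ht0).1 (hLb t ht0).2.1 (hLb t ht0).2.2
      (Lb (s + t - 1)) (hLb _ hst).1 (hLb _ hst).2.1 (hLb _ hst).2.2
    have hprod : 0 < g (Lb s) * g (Lb t) / 2 := by
      have := mul_pos (hIoo s).1 (hIoo t).1; positivity
    have hlog := Real.log_le_log hprod h
    rw [Real.log_div (mul_pos (hIoo s).1 (hIoo t).1).ne' two_ne_zero,
      Real.log_mul (hIoo s).1.ne' (hIoo t).1.ne'] at hlog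
    show -Real.log (g (Lb (s + t - 1))) ≤ -Real.log (g (Lb s)) + -Real.log (g (Lb t)) + Real.log 2
    linarith
  obtain ⟨l, h1, h2, hup, hlow⟩ := quasiadditive_linear_sandwich a (Real.log 2)
    (Real.log_nonneg one_le_two) hmono hnn hsup hsub
  -- `a 1 = log 2`
  have ha1 : a 1 = Real.log 2 := by
    have hsq : g (Lb 1) = 1 / 2 :=
      lrSquare_eq_half hu hg one_pos (Lb 1) (x₀ := 0) (y₀ := 0) (by simpa using (hLb 1 one_pos).1)
        (by simpa using (hLb 1 one_pos).2.1) (by simpa using (hLb 1 one_pos).2.2)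
    show -Real.log (g (Lb 1)) = Real.log 2
    rw [hsq, one_div, Real.log_inv, neg_neg]
  have hl2 : Real.log 2 ≤ l := ha1 ▸ h1
  have hl0 : 0 < l := (Real.log_pos one_lt_two).trans_le hl2
  refine ⟨l, hl2, ?_, ?_⟩
  · intro L₂ hc h0 h2
    have hval : g (Lb 2) = g L₂ :=
      congr hg ((hLb 2 two_pos).1.trans hc.symm) ((hLb 2 two_pos).2.1.trans h0.symm)
        ((hLb 2 two_pos).2.2.trans h2.symm)
    have : a 2 = -Real.log (g L₂) := by show -Real.log (g (Lb 2)) = _; rw [hval]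
    linarith [h2, this]
  · intro w hw L hc h0 h2
    have hval : g L = g (Lb w) :=
      congr hg (hc.trans (hLb w hw).1.symm) (h0.trans (hLb w hw).2.1.symm) (h2.trans (hLb w hw).2.2.symm)
    have hpos : 0 < g L := (jointLimit_mem_Ioo hu hg L).1
    constructor
    · -- `a w ≤ l w`
      have haw : -Real.log (g L) ≤ l * w := by rw [hval]; exact hup w hw
      rw [← Real.le_log_iff_exp_le hpos]
      linarith
    · rcases le_or_gt 1 w with hw1 | hw1
      · -- `a w ≥ l (w - 1) - log 2`
        have haw : l * (w - 1) - Real.log 2 ≤ -Real.log (g L) := by rw [hval]; exact hlow w hw1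
        have hle : Real.log (g L) ≤ Real.log 2 + l * (1 - w) := by linarith
        calc g L = Real.exp (Real.log (g L)) := (Real.exp_log hpos).symm
          _ ≤ Real.exp (Real.log 2 + l * (1 - w)) := Real.exp_le_exp.2 hle
          _ = 2 * Real.exp (l * (1 - w)) := by rw [Real.exp_add, Real.exp_log two_pos]
      · -- short boxes: `g L ≤ 1 ≤ 2 e^{l (1 - w)}`
        have h1' : g L ≤ 1 := (jointLimit_mem_Ioo hu hg L).2.le
        have hexp : 1 ≤ Real.exp (l * (1 - w)) := Real.one_le_exp (by nlinarith)
        linarith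

end JointLimit

/-- **Sub-goal `jointLimit_stripExponent` (line `registered`, lead c6; kernel facts IV, part 3) — the
STRIP CROSSING EXPONENT of every joint sequential limit of bond-`ℤ²` crossing probabilities.**
[cite: BollobasRiordan2006, Ch. 3, eq. (2), (3) and (12)] -/
theorem jointLimit_stripExponent : ∀ u : ℕ → ℝ, Filter.Tendsto u Filter.atTop (nhdsWithin (0 : ℝ) (Set.Ioi 0)) → ∀ g : Literature.Probability.RandomPlanarGeometry.ConformalRectangle → ℝ, (∀ R : Literature.Probability.RandomPlanarGeometry.ConformalRectangle, Filter.Tendsto (fun n => Literature.Probability.Percolation.bondDomainCrossingProb R (u n)) Filter.atTop (nhds (g R))) → ∃ l : ℝ, Real.log 2 ≤ l ∧ (∀ L₂ : Literature.Probability.RandomPlanarGeometry.ConformalRectangle, L₂.carrier = (Set.Ioo (0:ℝ) 2 ×ℂ Set.Ioo (0:ℝ) 1) → L₂.arc 0 = {z : ℂ | z.re = 0 ∧ z.im ∈ Set.Icc (0:ℝ) 1} → L₂.arc 2 = {z : ℂ | z.re = 2 ∧ z.im ∈ Set.Icc (0:ℝ) 1} → l ≤ Real.log 2 - Real.log (g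 L₂)) ∧ (∀ w : ℝ, 0 < w → ∀ L : Literature.Probability.RandomPlanarGeometry.ConformalRectangle, L.carrier = (Set.Ioo (0:ℝ) w ×ℂ Set.Ioo (0:ℝ) 1) → L.arc 0 = {z : ℂ | z.re = 0 ∧ z.im ∈ Set.Icc (0:ℝ) 1} → L.arc 2 = {z : ℂ | z.re = w ∧ z.im ∈ Set.Icc (0:ℝ) 1} → Real.exp (-(l * w)) ≤ g L ∧ g L ≤ 2 * Real.exp (l * (1 - w))) :=
  fun _ hu _ hg => JointLimit.exists_stripExponent hu hg

/-- **Sub-goal `seqKernel_boundaryQuasiPower` (line `registered`, lead c6; kernel facts IV, part 5) —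
every SEQUENTIAL CROSSING KERNEL is a quasi-exponential of the aspect ratio at the boundary.** If
`u n → 0⁺` and `bondDomainCrossingProb R (u n) → f (crossRatio x)` for every conformal rectangle and
every uniformizing datum (HYPSEQ of items 8271 / 4680 / 8850), and `η` is the Bollobás–Riordan modulus of
the rectangle (`rectangle_crossRatio_eq_of_aspectRatio_holds`), then for some `l ≥ log 2` and all
`w > 0`: `e^{-l w} ≤ f (η w) ≤ 2 e^{l (1 - w)}` (`Kernel.lr_eq`: `f (η w)` is the left-to-right value
of the box `(0,w) × (0,1)`). For Cardy's `F`, `l = π / 3`. [cite: BollobasRiordan2006, Ch. 7 §7.1 p. 184] -/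
theorem seqKernel_boundaryQuasiPower : ∀ u : ℕ → ℝ, Filter.Tendsto u Filter.atTop (nhdsWithin (0 : ℝ) (Set.Ioi 0)) → ∀ f : ℝ → ℝ, (∀ (R : Literature.Probability.RandomPlanarGeometry.ConformalRectangle) (φ : Literature.Probability.RandomPlanarGeometry.ConformalEquiv UpperHalfPlane.upperHalfPlaneSet R.carrier) (x : Fin 4 → ℝ), R.IsUniformizing φ x → Filter.Tendsto (fun n => Literature.Probability.Percolation.bondDomainCrossingProb R (u n)) Filter.atTop (nhds (f (Literature.Probability.RandomPlanarGeometry.crossRatio x)))) → ∀ η : ℝ → ℝ, η '' Set.Ioi 0 = Set.Ioo 0 1 → (∀ (R : Literature.Probability.RandomPlanarGeometry.ConformalRectangle) (w h : ℝ), 0 < w → 0 < h → R.carrier = (Set.Ioo (0:ℝ) w ×ℂ Set.Ioo (0:ℝ) h) → (R.pt 0 = (h:ℂ) * Complex.I ∧ R.pt 1 = 0 ∧ R.pt 2 = (w:ℂ) ∧ R.pt 3 = (w:ℂ) + (h:ℂ) * Complex.I) → ∀ (φ : Literature.Probability.RandomPlanarGeometry.ConformalEquiv UpperHalfPlane.upperHalfPlaneSet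 R.carrier) (x : Fin 4 → ℝ), R.IsUniformizing φ x → Literature.Probability.RandomPlanarGeometry.crossRatio x = η (w / h)) → ∃ l : ℝ, Real.log 2 ≤ l ∧ ∀ w : ℝ, 0 < w → Real.exp (-(l * w)) ≤ f (η w) ∧ f (η w) ≤ 2 * Real.exp (l * (1 - w)) := by
  intro u hu f hf η himg hη
  obtain ⟨g, hg, -⟩ := Kernel.exists_jointLimit hf
  obtain ⟨l, hl2, -, hsand⟩ := JointLimit.exists_stripExponent hu hg
  refine ⟨l, hl2, fun w hw => ?_⟩
  have hηw : η w ∈ Ioo (0:ℝ) 1 := himg ▸ mem_image_of_mem η hw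
  obtain ⟨L, hc, h0, h2⟩ := JointLimit.exists_lrBox w hw
  rw [← Kernel.lr_eq hu hf hg hη hw hηw L hc h0 h2]
  exact hsand w hw L hc h0 h2

/-! ### The exponent on the cluster set `Λ'` -/

/-- **Sub-goal `clusterPt_stripExponent` (line `registered`, lead c6; kernel facts IV, part 6a) — every
point of the cluster set `Λ'` of the bond-`ℤ²` crossing-function path has a UNIQUE strip crossing
exponent** (cluster points are joint sequential limits, `JointLimit.exists_tendsto_of_mapClusterPt`;
existence by `JointLimit.exists_stripExponent`, uniqueness by `stripSandwich_unique`).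
[cite: BollobasRiordan2006, Ch. 3, eq. (2), (3) and (12)] -/
theorem clusterPt_stripExponent : ∀ g ∈ Summit.CriticalPhenomena.CardyFormulaZ2.Theorems.CardyShadowIsolated.DilationDynamics.clusterSet, ∃! l : ℝ, ∀ w : ℝ, 0 < w → ∀ L : Literature.Probability.RandomPlanarGeometry.ConformalRectangle, L.carrier = (Set.Ioo (0:ℝ) w ×ℂ Set.Ioo (0:ℝ) 1) → L.arc 0 = {z : ℂ | z.re = 0 ∧ z.im ∈ Set.Icc (0:ℝ) 1} → L.arc 2 = {z : ℂ | z.re = w ∧ z.im ∈ Set.Icc (0:ℝ) 1} → Real.exp (-(l * w)) ≤ g L ∧ g L ≤ 2 * Real.exp (l * (1 - w)) := by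
  intro g hg
  obtain ⟨u, hu, hgu⟩ := JointLimit.exists_tendsto_of_mapClusterPt hg
  obtain ⟨l, -, -, hs⟩ := JointLimit.exists_stripExponent hu hgu
  exact ⟨l, hs, fun l' hl' => stripSandwich_unique g l' l hl' hs⟩

/-- **Sub-goal `clusterSet_stripExponent_bounds` (line `registered`, lead c6; kernel facts IV, part 6b)
— the strip crossing exponent is uniformly bounded on the cluster set**: whenever `l` sandwiches
`g ∈ Λ'`, `log 2 ≤ l ≤ M` with ONE constant `M` (the unit square has value `1/2`, and by compactness
of `Λ'` and RSW the width-`2` box has a value bounded away from `0` uniformly over `Λ'`).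
[cite: BollobasRiordan2006, Ch. 3, Lemma 1 and eq. (3)] -/
theorem clusterSet_stripExponent_bounds : ∃ M : ℝ, ∀ g ∈ Summit.CriticalPhenomena.CardyFormulaZ2.Theorems.CardyShadowIsolated.DilationDynamics.clusterSet, ∀ l : ℝ, (∀ w : ℝ, 0 < w → ∀ L : Literature.Probability.RandomPlanarGeometry.ConformalRectangle, L.carrier = (Set.Ioo (0:ℝ) w ×ℂ Set.Ioo (0:ℝ) 1) → L.arc 0 = {z : ℂ | z.re = 0 ∧ z.im ∈ Set.Icc (0:ℝ) 1} → L.arc 2 = {z : ℂ | z.re = w ∧ z.im ∈ Set.Icc (0:ℝ) 1} → Real.exp (-(l * w)) ≤ g L ∧ g L ≤ 2 * Real.exp (l * (1 - w))) → Real.log 2 ≤ l ∧ l ≤ M := by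
  obtain ⟨L₂, hc₂, h0₂, h2₂⟩ := JointLimit.exists_lrBox 2 two_pos
  obtain ⟨L₁, hc₁, h0₁, h2₁⟩ := JointLimit.exists_lrBox 1 one_pos
  -- a uniform positive lower bound of `g L₂` over the compact set `Λ'`
  obtain ⟨g₀, hg₀, hmin⟩ := Recurrent.isCompact_clusterSet.exists_isMinOn Recurrent.clusterSet_nonempty
    ((continuous_apply L₂).continuousOn)
  obtain ⟨u₀, hu₀, hgu₀⟩ := JointLimit.exists_tendsto_of_mapClusterPt hg₀
  have hc0 : 0 < g₀ L₂ := (jointLimit_mem_Ioo hu₀ hgu₀ L₂).1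
  refine ⟨Real.log 2 - Real.log (g₀ L₂), fun g hg l hs => ?_⟩
  obtain ⟨u, hu, hgu⟩ := JointLimit.exists_tendsto_of_mapClusterPt hg
  constructor
  · -- the unit square: `e^{-l} ≤ g L₁ = 1/2`
    have hsq : g L₁ = 1 / 2 :=
      JointLimit.lrSquare_eq_half hu hgu one_pos L₁ (x₀ := 0) (y₀ := 0) (by simpa using hc₁)
        (by simpa using h0₁) (by simpa using h2₁)
    have h := (hs 1 one_pos L₁ hc₁ h0₁ h2₁).1
    rw [mul_one, hsq] at h
    have := (Real.le_log_iff_exp_le (by norm_num : (0:ℝ) < 1 / 2)).2 h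
    rw [one_div, Real.log_inv] at this
    linarith
  · -- the width-2 box: `g₀ L₂ ≤ g L₂ ≤ 2 e^{-l}`
    have h := (hs 2 two_pos L₂ hc₂ h0₂ h2₂).2
    have hmin' : g₀ L₂ ≤ g L₂ := hmin hg
    have hle : g₀ L₂ ≤ 2 * Real.exp (l * (1 - 2)) := hmin'.trans h
    have hlog := Real.log_le_log hc0 hle
    rw [Real.log_mul two_ne_zero (Real.exp_pos _).ne', Real.log_exp] at hlog
    linarith

end Summit.CriticalPhenomena.CardyFormulaZ2.Cruxes.SubseqCardy.Birth

end
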